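import Literature.MathematicalPhysics.QuantumFieldTheory.Balaban1983to89.B9Ineq344LocalPairHolds
import Literature.MathematicalPhysics.QuantumFieldTheory.Balaban1983to89.B9Ineq347GAAtLetters
import Literature.MathematicalPhysics.QuantumFieldTheory.Balaban1983to89.B9BackgroundsKLevelV1R

/-!
# `Balaban1983to89.B9ResidualGpGAAtLettersR` — ROWS `hGp` ((3.43)–(3.46) residual entries of G′(1)) AND `hGA` ((3.47) for G(1)) OF THE N06 KNIT,
# RE-PRESSED ONCE OVER THE CLASS-PARAMETRIC CARRIER `bg9YR R₁ R₂` (dag-lead CASCADE-R; the R-twins of `B9Ineq344LocalPairHolds.hGp_opsYOfLetters_holds`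
# and `B9Ineq347GAAtLetters.hGA_opsYOfLetters`)

B9 = T. Bałaban, *Propagators for lattice gauge theories in a background field*, Commun. Math. Phys. **99** (1985) 389–434 [`Balaban1985BackgroundPropagators`];
[4] = T. Bałaban, *Propagators and renormalization transformations for lattice gauge theories. II*, Commun. Math. Phys. **96** (1984) 223–250 [`Balaban1984PropagatorsII`];
[B5] = part I, Commun. Math. Phys. **95** (1984) 17–40 [`Balaban1984PropagatorsI`].
pub-ymgap Track A, node N06 = `Dag.B9_main`; seat `pub-ymgap-dag-n06-h` g16 (bundle F3, rows 9–12); plan of record dag-lead CASCADE-R (the certificate's edition 8 is pressed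
at `B9PinCarriersKLevelV1R.carriersYR … R₁ R₂ ops`, whose binders `hGp` ∕ `hGA` read
`B9FromB6.ResidualGpAtOne geo9Y (bg9YR 𝔸 G R₁ R₂) (fun x => kernelFamilyR R₁ R₂ (ops x).Gp)` ∕ `B9FromB6.ResidualGAGlobAtOne geo9Y (bg9YR 𝔸 G R₁ R₂) (fun x => kernelFamilyR R₁ R₂ (ops x).GA)`).
APPEND-ONLY companion of `B9Ineq344LocalPairHolds` (row 11 = `hGp`, g5), `B9Ineq347GAAtLetters` (row 12 = `hGA`, g2), `B9ResidualEntriesAtOne(AtLetters)` (g0∕g2) and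
def-Y's MODULE 3-R `B9BackgroundsKLevelV1R` — all untouched, consumed by name.  PROOF LANE: 0 `def`; nothing of [B9] asserted; count-neutral; N06 NOT discharged.

WHY THESE ROWS ARE CLASS-FREE (kernel fact).  The `U = 1` predicates `B9FromB6.ResidualGpAtOne ∕ ResidualGAGlobAtOne geo bg K` and the finer leaves
`B9ResidualEntriesAtOne.AtOneL2On ∕ AtOneGlobOn ∕ AtOneH1On ∕ AtOneE4On ∕ AtOneH2On ∕ AtOneL2nOn ∕ AtOneGlobnOn ∕ NullOffAtOne geo bg K P` read the background
carrier `bg` ONLY through the configuration `(bg i).one` and the kernel-entry functionals of `K i` (`.e .h1 .e4 .h2 .l2 .glob`); they never read the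
regularity classes (3.35)–(3.36).  Since `(bg9YR 𝔸 G R₁ R₂ x).one = (bg9Y 𝔸 G x).one` and `kernelFamilyR R₁ R₂ K = ⟨K.e, K.h1, K.e4, K.h2, K.l2, K.glob⟩`
DEFINITIONALLY (`B9BackgroundsKLevelV1R.bg9YR_one_eq`, `kernelFamilyR_e` …, all `rfl`), each such predicate at `(bg9YR 𝔸 G R₁ R₂, fun x => kernelFamilyR R₁ R₂ (K x))`
IS the same predicate at `(bg9Y 𝔸 G, K)` — §1 records the nine identifications as `Iff.rfl`, for EVERY pair of regularity families `R₁ R₂` and EVERY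
kernel family `K` (no class axiom `MemOfFam` ∕ `Imp336335` is consumed).  Hence rows 11 and 12 of the knit, PROVED at `bg9Y` for every layer of letters
(`B9Ineq344LocalPairHolds.residualGpAtOne_letters_holds`, `B9Ineq347GAAtLetters.residualGAGlobAtOne_GA_letters`), hold VERBATIM over `bg9YR R₁ R₂` (§2), and
so do the record faces at `ops := Node00.opsYOfLetters N θ M⋆ 𝔏 𝔈` (§3) — the same proof terms, read by `exact`.

WHAT IS PROVED.
* §1 (transports, `Iff.rfl`, generic `K`, `P`, `n`): `residualGpAtOne_R_iff`, `residualGAGlobAtOne_R_iff`, `atOneL2On_R_iff`, `atOneGlobOn_R_iff`, `atOneH1On_R_iff`,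
  `atOneE4On_R_iff`, `atOneH2On_R_iff`, `atOneL2nOn_R_iff`, `atOneGlobnOn_R_iff`, `nullOffAtOne_R_iff`.
* §2 (layer of letters, every `𝔏 𝔈`, every `R₁ R₂`): ★★ `residualGpAtOne_letters_holds_R` (row 11, NO hypothesis), ★★ `residualGAGlobAtOne_GA_letters_R` (row 12, band `0 < b₀ ≤ b₁`),
  and the finer leaves `atOneE4On_Gp_letters_R` ∕ `atOneH2On_Gp_letters_R` ((3.44)∕(3.45) ON site arguments, NO hypothesis), `atOneGlobOn_GA_letters_R` ((3.47) ON bond arguments).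
* §3 (the record, SU(N)): ★★★ `hGp_opsYOfLetters_holds_R N θ M⋆ 𝔏 𝔈 R₁ R₂` and ★★★ `hGA_opsYOfLetters_R N θ M⋆ 𝔏 𝔈 R₁ R₂` — LITERALLY the binders `hGp` ∕ `hGA` of
  `B9PinCarriersKLevelV1R.b9LeafX_carriersYR` at `ops := opsYOfLetters N θ M⋆ 𝔏 𝔈` (and, the `.Gp ∕ .GA` fields of every instance of record being `opsYOfLetters`'s by `rfl`,
  at `opsYOfRecord… ∕ opsYNuOfRecordV4E …` by `exact`); coherence `hGp_opsYOfLetters_holds_R_regY_iff` ∕ `hGA_opsYOfLetters_R_regY_iff` (`Iff.rfl`: at MODULE 3's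
  families `(regY335, regY336)` the re-pressed face IS the landed one) and the faces at print's class `hGp_opsYOfLetters_holds_P` ∕ `hGA_opsYOfLetters_P`
  (at `(regYP335, regYP336)`, i.e. over `bg9YP` by `B9BackgroundsKLevelV1R.bg9YP_eq_bg9YR`).
HONEST SCOPE: re-typing bookkeeping over landed theorems (row 11: the located [B5] Prop 1.2 clauses of the charted one-level torus operator, g4∕g5; row 12: [4] (2.136) on
N03's census + Lemma 2.1, g2); the class (3.35)–(3.36) is a PARAMETER nothing here reads; one finite lattice programme; NOT continuum ∕ OS ∕ mass gap ∕ Clay.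
No `sorry`, no `axiom`, no `instance`, no `notation`, default heartbeats.
-/

noncomputable section

namespace Literature.MathematicalPhysics.QuantumFieldTheory.Balaban1983to89.B9ResidualGpGAAtLettersR

open B9FromB6 (ResidualGpAtOne ResidualGAGlobAtOne)
open B9ResidualEntriesAtOne (AtOneL2On AtOneGlobOn AtOneH1On AtOneE4On AtOneH2On AtOneL2nOn AtOneGlobnOn NullOffAtOne)
open B9PinMembersKLevelV1 (MemberY geo9Y bg9Y)
open B9BackgroundsKLevelV1P (bg9YP)
open B9BackgroundsKLevelV1R (RegFamY bg9YR regY335 regY336 regYP335 regYP336 kernelFamilyR)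
open B9Ineq344LocalPairHolds (ineq344GpKIdx_holds ineq345GpKIdx_holds residualGpAtOne_letters_holds hGp_opsYOfLetters_holds)
open B9Ineq344GpAtLetters (atOneE4On_Gp_letters_of_ineq344 atOneH2On_Gp_letters_of_ineq344_345)
open B9Ineq347GAAtLetters (atOneGlobOn_GA_letters residualGAGlobAtOne_GA_letters hGA_opsYOfLetters)
open B7Prop2SpecialUnitary (specialUnitaryUnits)
open Node00

variable {d ℓ : ℕ} {hd : 1 ≤ d + 1} {hL : Odd (ℓ + 1) ∧ 1 < ℓ + 1} {b₀ b₁ : ℝ} {Mstar : ℕ}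
variable {𝔸 : Type} [NormedRing 𝔸] [NormedAlgebra ℂ 𝔸] [CompleteSpace 𝔸] {G : Subgroup 𝔸ˣ}

/-! ## §1 The `U = 1` residual predicates over `bg9YR R₁ R₂` ARE those over `bg9Y` (definitionally; every `R₁ R₂`, every kernel family) -/

section Transport

variable (R₁ R₂ : RegFamY d ℓ hd hL b₀ b₁ Mstar 𝔸)
  (K : ∀ x : MemberY d ℓ hd hL b₀ b₁ Mstar, B9.KernelFamily (geo9Y x) (bg9Y 𝔸 G x))
  (P : ∀ x : MemberY d ℓ hd hL b₀ b₁ Mstar, (geo9Y x).Loc → Prop)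

/-- the residual entries (3.43)–(3.47) of G′(1) over the class-parametric carrier ARE those over MODULE 3's carrier (the predicate reads `bg` only through
`.one` and the kernel entries, both unchanged by the re-typing). [cite: Balaban1985BackgroundPropagators, Cor. 3.5 p.407 + (3.43)–(3.47) p.398; p.396 (the class as a parameter — bookkeeping)] -/
theorem residualGpAtOne_R_iff :
    ResidualGpAtOne geo9Y (bg9YR 𝔸 G R₁ R₂) (fun x => kernelFamilyR R₁ R₂ (K x)) ↔ ResidualGpAtOne geo9Y (bg9Y 𝔸 G) K :=
  Iff.rfl

/-- the global entries (3.47) of G(1) over the class-parametric carrier ARE those over MODULE 3's carrier.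
[cite: Balaban1985BackgroundPropagators, Cor. 3.5 p.407 + (3.47) p.398; p.396 (bookkeeping)] -/
theorem residualGAGlobAtOne_R_iff :
    ResidualGAGlobAtOne geo9Y (bg9YR 𝔸 G R₁ R₂) (fun x => kernelFamilyR R₁ R₂ (K x)) ↔ ResidualGAGlobAtOne geo9Y (bg9Y 𝔸 G) K :=
  Iff.rfl

/-- the (3.46) leaf at `U = 1` ON `P` transports verbatim. [cite: Balaban1985BackgroundPropagators, Cor. 3.5 p.407 + (3.46) p.398 (bookkeeping)] -/
theorem atOneL2On_R_iff :
    AtOneL2On geo9Y (bg9YR 𝔸 G R₁ R₂) (fun x => kernelFamilyR R₁ R₂ (K x)) P ↔ AtOneL2On geo9Y (bg9Y 𝔸 G) K P :=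
  Iff.rfl

/-- the (3.47) leaf at `U = 1` ON `P` transports verbatim. [cite: Balaban1985BackgroundPropagators, Cor. 3.5 p.407 + (3.47) p.398 (bookkeeping)] -/
theorem atOneGlobOn_R_iff :
    AtOneGlobOn geo9Y (bg9YR 𝔸 G R₁ R₂) (fun x => kernelFamilyR R₁ R₂ (K x)) P ↔ AtOneGlobOn geo9Y (bg9Y 𝔸 G) K P :=
  Iff.rfl

/-- the (3.43) leaf at `U = 1` ON `P` transports verbatim. [cite: Balaban1985BackgroundPropagators, Cor. 3.5 p.407 + (3.43) p.398 (bookkeeping)] -/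
theorem atOneH1On_R_iff :
    AtOneH1On geo9Y (bg9YR 𝔸 G R₁ R₂) (fun x => kernelFamilyR R₁ R₂ (K x)) P ↔ AtOneH1On geo9Y (bg9Y 𝔸 G) K P :=
  Iff.rfl

/-- the (3.44) leaf at `U = 1` ON `P` transports verbatim. [cite: Balaban1985BackgroundPropagators, Cor. 3.5 p.407 + (3.44) p.398 (bookkeeping)] -/
theorem atOneE4On_R_iff :
    AtOneE4On geo9Y (bg9YR 𝔸 G R₁ R₂) (fun x => kernelFamilyR R₁ R₂ (K x)) P ↔ AtOneE4On geo9Y (bg9Y 𝔸 G) K P :=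
  Iff.rfl

/-- the (3.45) leaf at `U = 1` ON `P` transports verbatim. [cite: Balaban1985BackgroundPropagators, Cor. 3.5 p.407 + (3.45) p.398 (bookkeeping)] -/
theorem atOneH2On_R_iff :
    AtOneH2On geo9Y (bg9YR 𝔸 G R₁ R₂) (fun x => kernelFamilyR R₁ R₂ (K x)) P ↔ AtOneH2On geo9Y (bg9Y 𝔸 G) K P :=
  Iff.rfl

/-- the (3.46) leaf at `U = 1` ON `P`, member `n`, transports verbatim. [cite: Balaban1985BackgroundPropagators, Cor. 3.5 p.407 + (3.46) p.398 (bookkeeping)] -/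
theorem atOneL2nOn_R_iff (n : Fin 6) :
    AtOneL2nOn geo9Y (bg9YR 𝔸 G R₁ R₂) (fun x => kernelFamilyR R₁ R₂ (K x)) P n ↔ AtOneL2nOn geo9Y (bg9Y 𝔸 G) K P n :=
  Iff.rfl

/-- the (3.47) leaf at `U = 1` ON `P`, member `n`, transports verbatim. [cite: Balaban1985BackgroundPropagators, Cor. 3.5 p.407 + (3.47) p.398 (bookkeeping)] -/
theorem atOneGlobnOn_R_iff (n : Fin 4) :
    AtOneGlobnOn geo9Y (bg9YR 𝔸 G R₁ R₂) (fun x => kernelFamilyR R₁ R₂ (K x)) P n ↔ AtOneGlobnOn geo9Y (bg9Y 𝔸 G) K P n :=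
  Iff.rfl

/-- the null readings OFF `P` transport verbatim. [cite: Balaban1985BackgroundPropagators, Cor. 3.5 p.407 (bookkeeping of the carriers' sum-typed arguments)] -/
theorem nullOffAtOne_R_iff :
    NullOffAtOne geo9Y (bg9YR 𝔸 G R₁ R₂) (fun x => kernelFamilyR R₁ R₂ (K x)) P ↔ NullOffAtOne geo9Y (bg9Y 𝔸 G) K P :=
  Iff.rfl

end Transport

/-! ## §2 Rows 11 and 12 at NODE 00's layer of letters, over `bg9YR R₁ R₂` -/

section Layer

variable (R₁ R₂ : RegFamY d ℓ hd hL b₀ b₁ Mstar 𝔸)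
  (𝔏 : ∀ x : MemberY d ℓ hd hL b₀ b₁ Mstar, CovLettersY 𝔸 x) (𝔈 : ∀ x : MemberY d ℓ hd hL b₀ b₁ Mstar, ExpLettersY 𝔸 G x)

/-- ★★ **ROW `hGp` AT NODE 00's LAYER OF LETTERS OVER THE CLASS-PARAMETRIC CARRIER, NO HYPOTHESIS** (every `R₁ R₂ 𝔏 𝔈`): the residual entries
(3.43)–(3.46) of G′(1) for the re-typed `Gp`-member of `operatorLayerYOfLetters` — `B9Ineq344LocalPairHolds.residualGpAtOne_letters_holds` read over `bg9YR`.
[cite: Balaban1985BackgroundPropagators, Cor. 3.5 p.407 + Thm 3.1 (3.43)–(3.47) p.398; Balaban1984PropagatorsII, Prop. 2.2 (2.67) p.234; Balaban1984PropagatorsI, Prop. 1.2 (1.110)–(1.113) p.36] -/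
theorem residualGpAtOne_letters_holds_R :
    ResidualGpAtOne geo9Y (bg9YR 𝔸 G R₁ R₂) (fun x => kernelFamilyR R₁ R₂ (operatorLayerYOfLetters 𝔸 G x (𝔏 x) (𝔈 x)).Gp) :=
  residualGpAtOne_letters_holds 𝔏 𝔈

/-- the (3.44) leaf of G′(1) ON site arguments at the layer of letters, over `bg9YR`, NO hypothesis (`B9Ineq344GpAtLetters.atOneE4On_Gp_letters_of_ineq344` at the
PROVED flat schema `B9Ineq344LocalPairHolds.ineq344GpKIdx_holds`, re-read). [cite: Balaban1985BackgroundPropagators, Cor. 3.5 p.407 + (3.44) p.398; Balaban1984PropagatorsI, Prop. 1.2 (1.112) p.36] -/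
theorem atOneE4On_Gp_letters_R :
    AtOneE4On geo9Y (bg9YR 𝔸 G R₁ R₂) (fun x => kernelFamilyR R₁ R₂ (operatorLayerYOfLetters 𝔸 G x (𝔏 x) (𝔈 x)).Gp) (fun _ lam => ¬ (lam.isRight = true)) :=
  atOneE4On_Gp_letters_of_ineq344 𝔏 𝔈 (ineq344GpKIdx_holds d ℓ hd hL b₀ b₁)

/-- the (3.45) leaf of G′(1) ON site arguments at the layer of letters, over `bg9YR`, NO hypothesis (`B9Ineq344GpAtLetters.atOneH2On_Gp_letters_of_ineq344_345` at the
PROVED flat schemas `ineq344GpKIdx_holds` ∕ `ineq345GpKIdx_holds`, re-read). [cite: Balaban1985BackgroundPropagators, Cor. 3.5 p.407 + (3.45) p.398; Balaban1984PropagatorsI, Prop. 1.2 (1.113) p.36] -/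
theorem atOneH2On_Gp_letters_R :
    AtOneH2On geo9Y (bg9YR 𝔸 G R₁ R₂) (fun x => kernelFamilyR R₁ R₂ (operatorLayerYOfLetters 𝔸 G x (𝔏 x) (𝔈 x)).Gp) (fun _ lam => ¬ (lam.isRight = true)) :=
  atOneH2On_Gp_letters_of_ineq344_345 𝔏 𝔈 (ineq344GpKIdx_holds d ℓ hd hL b₀ b₁) (ineq345GpKIdx_holds d ℓ hd hL b₀ b₁)

variable (hb₀ : 0 < b₀) (hb₁ : b₀ ≤ b₁)
include hb₀ hb₁

/-- the (3.47) leaf of G(1) ON bond arguments at the layer of letters, over `bg9YR` (`B9Ineq347GAAtLetters.atOneGlobOn_GA_letters` re-read; band `0 < b₀ ≤ b₁`).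
[cite: Balaban1985BackgroundPropagators, Thm 3.3 p.399 + (3.47) p.398 + Cor. 3.5 p.407; Balaban1984PropagatorsII, Prop. 2.6 (2.136) p.247, Lemma 2.1 p.234] -/
theorem atOneGlobOn_GA_letters_R :
    AtOneGlobOn geo9Y (bg9YR 𝔸 G R₁ R₂) (fun x => kernelFamilyR R₁ R₂ (operatorLayerYOfLetters 𝔸 G x (𝔏 x) (𝔈 x)).GA) (fun _ lam => lam.isRight = true) :=
  atOneGlobOn_GA_letters hb₀ hb₁ 𝔏 𝔈

/-- ★★ **ROW `hGA` AT NODE 00's LAYER OF LETTERS OVER THE CLASS-PARAMETRIC CARRIER** (every `R₁ R₂ 𝔏 𝔈`, band `0 < b₀ ≤ b₁`): (3.47) at `U = 1` for the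
re-typed `GA`-member — `B9Ineq347GAAtLetters.residualGAGlobAtOne_GA_letters` read over `bg9YR`.
[cite: Balaban1985BackgroundPropagators, Thm 3.3 p.399 + (3.47) p.398 + Cor. 3.5 p.407; Balaban1984PropagatorsII, Prop. 2.6 (2.136) p.247, Lemma 2.1 p.234] -/
theorem residualGAGlobAtOne_GA_letters_R :
    ResidualGAGlobAtOne geo9Y (bg9YR 𝔸 G R₁ R₂) (fun x => kernelFamilyR R₁ R₂ (operatorLayerYOfLetters 𝔸 G x (𝔏 x) (𝔈 x)).GA) :=
  residualGAGlobAtOne_GA_letters hb₀ hb₁ 𝔏 𝔈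

end Layer

/-! ## §3 At the record: the knit binders `hGp` ∕ `hGA` of `b9LeafX_carriersYR` at `ops := opsYOfLetters N θ M⋆ 𝔏 𝔈` -/

section Record

open scoped Matrix.Norms.L2Operator

variable (N : ℕ) (θ : Stage3Params) (Mstar' : ℕ) (𝔏 : LettersY N θ Mstar') (𝔈 : ExpsY N θ Mstar')
  (R₁ R₂ : RegFamY θ.d₆ θ.ℓ₆ θ.hd' θ.hL' θ.b₀ θ.b₁ Mstar' (Matrix (Fin N) (Fin N) ℂ))

/-- ★★★ **ROW `hGp` OF THE N06 KNIT AT THE RECORD'S LAYER OF LETTERS, OVER THE CLASS-PARAMETRIC CARRIER, NO HYPOTHESIS** — LITERALLY the binder `hGp` of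
`B9PinCarriersKLevelV1R.b9LeafX_carriersYR` at `ops := opsYOfLetters N θ M⋆ 𝔏 𝔈`, for EVERY pair of regularity families `R₁ R₂` (the R-twin of
`B9Ineq344LocalPairHolds.hGp_opsYOfLetters_holds`; same proof term). [cite: Balaban1985BackgroundPropagators, Cor. 3.5 p.407 + Thm 3.1 (3.43)–(3.47) p.398; Balaban1984PropagatorsI, Prop. 1.2 (1.110)–(1.113) p.36] -/
theorem hGp_opsYOfLetters_holds_R :
    ResidualGpAtOne geo9Y (bg9YR (Matrix (Fin N) (Fin N) ℂ) (specialUnitaryUnits (Fin N)) R₁ R₂)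
      (fun x => kernelFamilyR R₁ R₂ (opsYOfLetters N θ Mstar' 𝔏 𝔈 x).Gp) :=
  hGp_opsYOfLetters_holds N θ Mstar' 𝔏 𝔈

/-- ★★★ **ROW `hGA` OF THE N06 KNIT AT THE RECORD'S LAYER OF LETTERS, OVER THE CLASS-PARAMETRIC CARRIER, NO HYPOTHESIS** — LITERALLY the binder `hGA` of
`B9PinCarriersKLevelV1R.b9LeafX_carriersYR` at `ops := opsYOfLetters N θ M⋆ 𝔏 𝔈`, for EVERY `R₁ R₂` (the R-twin of `B9Ineq347GAAtLetters.hGA_opsYOfLetters`; band from `θ.hb`).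
[cite: Balaban1985BackgroundPropagators, Cor. 3.5 p.407 + Thm 3.3 p.399 + (3.47) p.398; Balaban1984PropagatorsII, Prop. 2.6 (2.136) p.247, Lemma 2.1 (2.60)–(2.61) p.234] -/
theorem hGA_opsYOfLetters_R :
    ResidualGAGlobAtOne geo9Y (bg9YR (Matrix (Fin N) (Fin N) ℂ) (specialUnitaryUnits (Fin N)) R₁ R₂)
      (fun x => kernelFamilyR R₁ R₂ (opsYOfLetters N θ Mstar' 𝔏 𝔈 x).GA) :=
  hGA_opsYOfLetters N θ Mstar' 𝔏 𝔈

/-- coherence: at MODULE 3's families `(regY335, regY336)` the re-pressed row `hGp` IS the landed one (`bg9Y_eq_bg9YR`, `kernelFamilyR_regY`, both `rfl`).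
[cite: Balaban1985BackgroundPropagators, p.396 + Cor. 3.5 p.407 (bookkeeping: the two readings of the class)] -/
theorem hGp_opsYOfLetters_holds_R_regY_iff :
    ResidualGpAtOne geo9Y
        (bg9YR (Matrix (Fin N) (Fin N) ℂ) (specialUnitaryUnits (Fin N)) (regY335 (Matrix (Fin N) (Fin N) ℂ) (specialUnitaryUnits (Fin N)))
          (regY336 (Matrix (Fin N) (Fin N) ℂ) (specialUnitaryUnits (Fin N))))
        (fun x => kernelFamilyR (regY335 (Matrix (Fin N) (Fin N) ℂ) (specialUnitaryUnits (Fin N)))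
          (regY336 (Matrix (Fin N) (Fin N) ℂ) (specialUnitaryUnits (Fin N))) (opsYOfLetters N θ Mstar' 𝔏 𝔈 x).Gp) ↔
      ResidualGpAtOne geo9Y (bg9Y (Matrix (Fin N) (Fin N) ℂ) (specialUnitaryUnits (Fin N))) (fun x => (opsYOfLetters N θ Mstar' 𝔏 𝔈 x).Gp) :=
  Iff.rfl

/-- coherence: at MODULE 3's families the re-pressed row `hGA` IS the landed one.
[cite: Balaban1985BackgroundPropagators, p.396 + Cor. 3.5 p.407 (bookkeeping: the two readings of the class)] -/
theorem hGA_opsYOfLetters_R_regY_iff :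
    ResidualGAGlobAtOne geo9Y
        (bg9YR (Matrix (Fin N) (Fin N) ℂ) (specialUnitaryUnits (Fin N)) (regY335 (Matrix (Fin N) (Fin N) ℂ) (specialUnitaryUnits (Fin N)))
          (regY336 (Matrix (Fin N) (Fin N) ℂ) (specialUnitaryUnits (Fin N))))
        (fun x => kernelFamilyR (regY335 (Matrix (Fin N) (Fin N) ℂ) (specialUnitaryUnits (Fin N)))
          (regY336 (Matrix (Fin N) (Fin N) ℂ) (specialUnitaryUnits (Fin N))) (opsYOfLetters N θ Mstar' 𝔏 𝔈 x).GA) ↔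
      ResidualGAGlobAtOne geo9Y (bg9Y (Matrix (Fin N) (Fin N) ℂ) (specialUnitaryUnits (Fin N))) (fun x => (opsYOfLetters N θ Mstar' 𝔏 𝔈 x).GA) :=
  Iff.rfl

/-- row `hGp` at PRINT's class: over `bg9YP` with `B9PinCarriersKLevelV1P`-style re-typed kernels = the R face at `(regYP335, regYP336)` (`bg9YP_eq_bg9YR`, `rfl`).
[cite: Balaban1985BackgroundPropagators, (3.35) p.396 («a number ≧ 10») + Cor. 3.5 p.407] -/
theorem hGp_opsYOfLetters_holds_P :
    ResidualGpAtOne geo9Y (bg9YP (Matrix (Fin N) (Fin N) ℂ) (specialUnitaryUnits (Fin N)))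
      (fun x => kernelFamilyR (regYP335 (Matrix (Fin N) (Fin N) ℂ) (specialUnitaryUnits (Fin N)))
        (regYP336 (Matrix (Fin N) (Fin N) ℂ) (specialUnitaryUnits (Fin N))) (opsYOfLetters N θ Mstar' 𝔏 𝔈 x).Gp) :=
  hGp_opsYOfLetters_holds N θ Mstar' 𝔏 𝔈

/-- row `hGA` at PRINT's class (over `bg9YP`). [cite: Balaban1985BackgroundPropagators, (3.35) p.396 («a number ≧ 10») + Cor. 3.5 p.407 + (3.47) p.398] -/
theorem hGA_opsYOfLetters_P :
    ResidualGAGlobAtOne geo9Y (bg9YP (Matrix (Fin N) (Fin N) ℂ) (specialUnitaryUnits (Fin N)))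
      (fun x => kernelFamilyR (regYP335 (Matrix (Fin N) (Fin N) ℂ) (specialUnitaryUnits (Fin N)))
        (regYP336 (Matrix (Fin N) (Fin N) ℂ) (specialUnitaryUnits (Fin N))) (opsYOfLetters N θ Mstar' 𝔏 𝔈 x).GA) :=
  hGA_opsYOfLetters N θ Mstar' 𝔏 𝔈

end Record

end Literature.MathematicalPhysics.QuantumFieldTheory.Balaban1983to89.B9ResidualGpGAAtLettersR

end
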